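import Summits.BirchSwinnertonDyer.BirchSwinnertonDyer.Theorems.KimAtThreeD7uRefinedModule
import HarnessLib

/-!
# D7-u, file C2′: the refined module on the FUNCTION-LEVEL ambient `C(U, X) × (G → X)`
# (route W2 = `KimAtThreeKolyvagin`, crux 19560 (C3) / TamDiv∞; seat `bsd-addord-w2-tamdiv`)

Technical twin of file C2 (`KimAtThreeD7uRefinedModule`).  The refined THEOREM A2 forms the
quotient module `S ⧸ N`; Lean's instance unification does not accept the quotient when the ambient
module has the cocycle SUBMODULE `Z¹(U, X)` as a factor (two instance paths through `TopRep.res`), so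
the ambient is taken to be `P₀ = C(U, X) × (G → X)` and "is a crossed homomorphism" becomes the
first defining condition (C0) of `S`.  Contents (no definition, no new mathematics):
`conj0_*` (the conjugation `f ↦ g • f(g⁻¹ · g)` on `C(U, X)`, agreeing with file A's action on
cocycles), `exists_submodule_refined₀`, `exists_submodule_null₀`, `exists_act₀` (linear,
multiplicative action on `P₀`), `act_combination₀` (file C2's `act_combination` read in `P₀`).

References: K. Rubin, *Euler Systems* (2000), §4.4; B. Mazur, K. Rubin, Mem. AMS 799 (2004), App. A.
-/

set_option autoImplicit false
-- the Theorems namespace of a single-conjunct summit repeats the summit name by design (D-0017)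
set_option linter.dupNamespace false

noncomputable section

open CategoryTheory Function Finset
open Literature.NumberTheory.GaloisRepresentations
open Literature.NumberTheory.EllipticCurves (subgroupConj subgroupConj_apply_coe)

universe u v

namespace Summit.BirchSwinnertonDyer.BirchSwinnertonDyer.Theorems.KimAtThreeD7uRefined

variable {R : Type v} [CommRing R] [TopologicalSpace R]
variable {G : Type u} [Group G] [TopologicalSpace G] [IsTopologicalGroup G]
variable (X T : TopRep.{u} R G) (U : Subgroup G) [U.Normal]

/-- Local notation: `𝔠⟦Y, g⟧ z` = the conjugate COCYCLE `x ↦ g • z(g⁻¹ x g)` on `U`. -/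
local notation3 (prettyPrint := false) "𝔠⟦" Y ", " g "⟧" =>
  contOneCocycles.pullback (subgroupConj U g) (conjRepHom Y U g)

/-- Local notation: `𝔠₀⟦g⟧ f` = the conjugate FUNCTION `x ↦ g • f(g⁻¹ x g)`, `f ∈ C(U, X)`. -/
local notation3 (prettyPrint := false) "𝔠₀⟦" g "⟧" => fun (f : C(U, X)) =>
  ((X.ρ g : X →L[R] X) : C(X, X)).comp (f.comp (subgroupConj U g : C(U, U)))

/-- Local notation: `𝐫⟦red⟧ c` = the reduced cocycle `red ∘ c` on `U`. -/
local notation3 (prettyPrint := false) "𝐫⟦" red "⟧" => contOneCocycles.pullback (ContinuousMonoidHom.id _)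
    (X := subgroupRep T U) (Y := subgroupRep X U) ((TopRep.resFunctor (Subgroup.subtype U)).map red)

/-! ### §1 Conjugation on `C(U, X)` -/

/-- Values: `(𝔠₀⟦g⟧ f)(x) = g • f(g⁻¹ x g)`. [folklore] -/
theorem conj0_apply (g : G) (f : C(U, X)) (x : U) :
    (𝔠₀⟦g⟧ f) x = X.ρ g (f ⟨g⁻¹ * x * g, (subgroupConj U g x).2⟩) := rfl

/-- On a crossed homomorphism the function-level conjugation is file A's action:
`𝔠₀⟦g⟧ z = (g · z)` as functions. [folklore] -/
theorem conj0_coe (g : G) (z : contOneCocycles (subgroupRep X U)) : (𝔠₀⟦g⟧ z.1) = (𝔠⟦X, g⟧ z).1 := by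
  ext x; rfl

/-- Conjugation preserves crossed homomorphisms. [folklore] -/
theorem conj0_mem (g : G) (f : C(U, X)) (hf : f ∈ contOneCocycles (subgroupRep X U)) :
    (𝔠₀⟦g⟧ f) ∈ contOneCocycles (subgroupRep X U) := by
  have h := conj0_coe X U g ⟨f, hf⟩
  change (𝔠₀⟦g⟧ f) = _ at h
  rw [h]
  exact (𝔠⟦X, g⟧ ⟨f, hf⟩).2

/-! ### §2 The submodules on the ambient `P₀ = C(U, X) × (G → X)` -/

variable (B : Submodule R X) (D I : Subgroup G)
variable (hIU : ∀ (g τ : G), τ ∈ I → g * τ * g⁻¹ ∈ U)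

omit [IsTopologicalGroup G] [U.Normal] in
/-- **The refined data form a submodule of `C(U, X) × (G → X)`**: pairs `(f, η)` with `f` a
crossed homomorphism (C0) satisfying (C1), (C2) and both parts of (L) (file A); stated as an
existence. [folklore] -/
theorem exists_submodule_refined₀ :
    ∃ S : Submodule R (C(U, X) × (G → X)), ∀ q, q ∈ S ↔
      (q.1 ∈ contOneCocycles (subgroupRep X U) ∧
       (∀ (u : G) (hu : u ∈ U) (g : G), q.2 (u * g) - q.2 g - X.ρ g⁻¹ (q.1 ⟨u⁻¹, U.inv_mem hu⟩) ∈ B) ∧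
       (∀ (g δ : G), δ ∈ D → q.2 (g * δ) - X.ρ δ⁻¹ (q.2 g) ∈ B) ∧
       (∀ (g δ : G), δ ∈ D → ∀ (h : g * δ * g⁻¹ ∈ U),
          X.ρ g⁻¹ (q.1 ⟨g * δ * g⁻¹, h⟩) - (X.ρ δ (q.2 g) - q.2 g) ∈ B) ∧
       (∀ (g τ : G) (hτ : τ ∈ I),
          X.ρ g⁻¹ (q.1 ⟨g * τ * g⁻¹, hIU g τ hτ⟩) - (X.ρ τ (q.2 g) - q.2 g) = 0)) := by
  set C : Set (C(U, X) × (G → X)) := {q |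
      q.1 ∈ contOneCocycles (subgroupRep X U) ∧
       (∀ (u : G) (hu : u ∈ U) (g : G), q.2 (u * g) - q.2 g - X.ρ g⁻¹ (q.1 ⟨u⁻¹, U.inv_mem hu⟩) ∈ B) ∧
       (∀ (g δ : G), δ ∈ D → q.2 (g * δ) - X.ρ δ⁻¹ (q.2 g) ∈ B) ∧
       (∀ (g δ : G), δ ∈ D → ∀ (h : g * δ * g⁻¹ ∈ U),
          X.ρ g⁻¹ (q.1 ⟨g * δ * g⁻¹, h⟩) - (X.ρ δ (q.2 g) - q.2 g) ∈ B) ∧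
       (∀ (g τ : G) (hτ : τ ∈ I),
          X.ρ g⁻¹ (q.1 ⟨g * τ * g⁻¹, hIU g τ hτ⟩) - (X.ρ τ (q.2 g) - q.2 g) = 0)} with hC
  refine ⟨{ carrier := C, add_mem' := ?_, zero_mem' := ?_, smul_mem' := ?_ }, fun q => Iff.rfl⟩
  · rintro q q' ⟨h0, h1, h2, h3, h4⟩ ⟨h0', h1', h2', h3', h4'⟩
    refine ⟨Submodule.add_mem _ h0 h0', fun u hu g => ?_, fun g δ hδ => ?_, fun g δ hδ h => ?_,
      fun g τ hτ => ?_⟩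
    · have e : (q + q').2 (u * g) - (q + q').2 g - X.ρ g⁻¹ ((q + q').1 ⟨u⁻¹, U.inv_mem hu⟩) =
          (q.2 (u * g) - q.2 g - X.ρ g⁻¹ (q.1 ⟨u⁻¹, U.inv_mem hu⟩)) +
          (q'.2 (u * g) - q'.2 g - X.ρ g⁻¹ (q'.1 ⟨u⁻¹, U.inv_mem hu⟩)) := by
        simp only [Prod.snd_add, Prod.fst_add, Pi.add_apply, ContinuousMap.add_apply, map_add]
        abel
      rw [e]; exact B.add_mem (h1 u hu g) (h1' u hu g)
    · have e : (q + q').2 (g * δ) - X.ρ δ⁻¹ ((q + q').2 g) =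
          (q.2 (g * δ) - X.ρ δ⁻¹ (q.2 g)) + (q'.2 (g * δ) - X.ρ δ⁻¹ (q'.2 g)) := by
        simp only [Prod.snd_add, Pi.add_apply, map_add]
        abel
      rw [e]; exact B.add_mem (h2 g δ hδ) (h2' g δ hδ)
    · have e : X.ρ g⁻¹ ((q + q').1 ⟨g * δ * g⁻¹, h⟩) - (X.ρ δ ((q + q').2 g) - (q + q').2 g) =
          (X.ρ g⁻¹ (q.1 ⟨g * δ * g⁻¹, h⟩) - (X.ρ δ (q.2 g) - q.2 g)) +
          (X.ρ g⁻¹ (q'.1 ⟨g * δ * g⁻¹, h⟩) - (X.ρ δ (q'.2 g) - q'.2 g)) := by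
        simp only [Prod.snd_add, Prod.fst_add, Pi.add_apply, ContinuousMap.add_apply, map_add]
        abel
      rw [e]; exact B.add_mem (h3 g δ hδ h) (h3' g δ hδ h)
    · have e : X.ρ g⁻¹ ((q + q').1 ⟨g * τ * g⁻¹, hIU g τ hτ⟩) -
            (X.ρ τ ((q + q').2 g) - (q + q').2 g) =
          (X.ρ g⁻¹ (q.1 ⟨g * τ * g⁻¹, hIU g τ hτ⟩) - (X.ρ τ (q.2 g) - q.2 g)) +
          (X.ρ g⁻¹ (q'.1 ⟨g * τ * g⁻¹, hIU g τ hτ⟩) - (X.ρ τ (q'.2 g) - q'.2 g)) := by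
        simp only [Prod.snd_add, Prod.fst_add, Pi.add_apply, ContinuousMap.add_apply, map_add]
        abel
      rw [e, h4 g τ hτ, h4' g τ hτ, add_zero]
  · refine ⟨Submodule.zero_mem _, fun u hu g => ?_, fun g δ hδ => ?_, fun g δ hδ h => ?_,
      fun g τ hτ => ?_⟩
    · simp only [Prod.snd_zero, Prod.fst_zero, Pi.zero_apply, ContinuousMap.zero_apply, map_zero,
        sub_self, Submodule.zero_mem]
    · simp only [Prod.snd_zero, Pi.zero_apply, map_zero, sub_self, Submodule.zero_mem]
    · simp only [Prod.snd_zero, Prod.fst_zero, Pi.zero_apply, ContinuousMap.zero_apply, map_zero,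
        sub_self, Submodule.zero_mem]
    · simp only [Prod.snd_zero, Prod.fst_zero, Pi.zero_apply, ContinuousMap.zero_apply, map_zero,
        sub_self]
  · rintro a q ⟨h0, h1, h2, h3, h4⟩
    refine ⟨Submodule.smul_mem _ a h0, fun u hu g => ?_, fun g δ hδ => ?_, fun g δ hδ h => ?_,
      fun g τ hτ => ?_⟩
    · have e : (a • q).2 (u * g) - (a • q).2 g - X.ρ g⁻¹ ((a • q).1 ⟨u⁻¹, U.inv_mem hu⟩) =
          a • (q.2 (u * g) - q.2 g - X.ρ g⁻¹ (q.1 ⟨u⁻¹, U.inv_mem hu⟩)) := by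
        simp only [Prod.smul_snd, Prod.smul_fst, Pi.smul_apply, ContinuousMap.smul_apply, map_smul,
          smul_sub]
      rw [e]; exact B.smul_mem a (h1 u hu g)
    · have e : (a • q).2 (g * δ) - X.ρ δ⁻¹ ((a • q).2 g) = a • (q.2 (g * δ) - X.ρ δ⁻¹ (q.2 g)) := by
        simp only [Prod.smul_snd, Pi.smul_apply, map_smul, smul_sub]
      rw [e]; exact B.smul_mem a (h2 g δ hδ)
    · have e : X.ρ g⁻¹ ((a • q).1 ⟨g * δ * g⁻¹, h⟩) - (X.ρ δ ((a • q).2 g) - (a • q).2 g) =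
          a • (X.ρ g⁻¹ (q.1 ⟨g * δ * g⁻¹, h⟩) - (X.ρ δ (q.2 g) - q.2 g)) := by
        simp only [Prod.smul_snd, Prod.smul_fst, Pi.smul_apply, ContinuousMap.smul_apply, map_smul,
          smul_sub]
      rw [e]; exact B.smul_mem a (h3 g δ hδ h)
    · have e : X.ρ g⁻¹ ((a • q).1 ⟨g * τ * g⁻¹, hIU g τ hτ⟩) -
            (X.ρ τ ((a • q).2 g) - (a • q).2 g) =
          a • (X.ρ g⁻¹ (q.1 ⟨g * τ * g⁻¹, hIU g τ hτ⟩) - (X.ρ τ (q.2 g) - q.2 g)) := by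
        simp only [Prod.smul_snd, Prod.smul_fst, Pi.smul_apply, ContinuousMap.smul_apply, map_smul,
          smul_sub]
      rw [e, h4 g τ hτ, smul_zero]

omit [IsTopologicalGroup G] [U.Normal] in
/-- **The null data form a submodule of `C(U, X) × (G → X)`**: pairs `(dα, η)` with
`η_g ≡ g⁻¹ α (mod B)`. [folklore] -/
theorem exists_submodule_null₀ :
    ∃ N : Submodule R (C(U, X) × (G → X)), ∀ q, q ∈ N ↔
      ∃ α : X, (∀ x : U, q.1 x = X.ρ (x : G) α - α) ∧ ∀ g, q.2 g - X.ρ g⁻¹ α ∈ B := by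
  set C : Set (C(U, X) × (G → X)) := {q |
      ∃ α : X, (∀ x : U, q.1 x = X.ρ (x : G) α - α) ∧ ∀ g, q.2 g - X.ρ g⁻¹ α ∈ B} with hC
  refine ⟨{ carrier := C, add_mem' := ?_, zero_mem' := ?_, smul_mem' := ?_ }, fun q => Iff.rfl⟩
  · rintro q q' ⟨α, hα, hη⟩ ⟨α', hα', hη'⟩
    refine ⟨α + α', fun x => ?_, fun g => ?_⟩
    · rw [Prod.fst_add, ContinuousMap.add_apply, hα, hα', map_add]; abel
    · have e : (q + q').2 g - X.ρ g⁻¹ (α + α') = (q.2 g - X.ρ g⁻¹ α) + (q'.2 g - X.ρ g⁻¹ α') := by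
        rw [Prod.snd_add, Pi.add_apply, map_add]; abel
      rw [e]; exact B.add_mem (hη g) (hη' g)
  · refine ⟨0, fun x => ?_, fun g => ?_⟩
    · simp only [Prod.fst_zero, ContinuousMap.zero_apply, map_zero, sub_self]
    · simp only [Prod.snd_zero, Pi.zero_apply, map_zero, sub_self, Submodule.zero_mem]
  · rintro a q ⟨α, hα, hη⟩
    refine ⟨a • α, fun x => ?_, fun g => ?_⟩
    · rw [Prod.smul_fst, ContinuousMap.smul_apply, hα, map_smul, smul_sub]
    · have e : (a • q).2 g - X.ρ g⁻¹ (a • α) = a • (q.2 g - X.ρ g⁻¹ α) := by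
        rw [Prod.smul_snd, Pi.smul_apply, map_smul, smul_sub]
      rw [e]; exact B.smul_mem a (hη g)

/-! ### §3 The linear action on `P₀` -/

/-- **The action `g · (f, η) = (g • f(g⁻¹ · g), η(g⁻¹ ·))` on `C(U, X) × (G → X)` is `R`-linear,
multiplicative and unital** (`∃` a family of linear maps). [folklore] -/
theorem exists_act₀ :
    ∃ act : G → (C(U, X) × (G → X)) →ₗ[R] (C(U, X) × (G → X)),
      (∀ g q, act g q = (𝔠₀⟦g⟧ q.1, fun h => q.2 (g⁻¹ * h))) ∧
      (∀ g g' q, act (g * g') q = act g (act g' q)) ∧ (∀ q, act 1 q = q) := by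
  refine ⟨fun g =>
    { toFun := fun q => (𝔠₀⟦g⟧ q.1, fun h => q.2 (g⁻¹ * h))
      map_add' := fun q q' => ?_
      map_smul' := fun a q => ?_ }, fun g q => rfl, fun g g' q => ?_, fun q => ?_⟩
  · ext1
    · ext x
      change X.ρ g ((q + q').1 _) = X.ρ g (q.1 _) + X.ρ g (q'.1 _)
      rw [Prod.fst_add, ContinuousMap.add_apply, map_add]
    · rfl
  · ext1
    · ext x
      change X.ρ g ((a • q).1 _) = a • X.ρ g (q.1 _)
      rw [Prod.smul_fst, ContinuousMap.smul_apply, map_smul]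
    · rfl
  · change ((𝔠₀⟦g * g'⟧ q.1, fun h => q.2 ((g * g')⁻¹ * h)) : C(U, X) × (G → X)) =
      (𝔠₀⟦g⟧ (𝔠₀⟦g'⟧ q.1), fun h => q.2 (g'⁻¹ * (g⁻¹ * h)))
    ext1
    · ext x
      rw [conj0_apply, conj0_apply, conj0_apply, ← ρ_mul_apply]
      congr 2
      apply Subtype.ext
      change (g * g')⁻¹ * (x : G) * (g * g') = g'⁻¹ * (g⁻¹ * x * g) * g'
      simp only [mul_inv_rev, mul_assoc]
    · funext h
      change q.2 ((g * g')⁻¹ * h) = q.2 (g'⁻¹ * (g⁻¹ * h))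
      rw [mul_inv_rev, mul_assoc]
  · change ((𝔠₀⟦(1 : G)⟧ q.1, fun h => q.2 ((1 : G)⁻¹ * h)) : C(U, X) × (G → X)) = q
    ext1
    · ext x
      rw [conj0_apply, map_one, one_apply_eq_self]
      exact congrArg _ (Subtype.ext (by change (1 : G)⁻¹ * x * 1 = x; group))
    · funext h
      change q.2 ((1 : G)⁻¹ * h) = q.2 h
      rw [inv_one, one_mul]

/-! ### §4 Linear combinations, read in `P₀` -/

variable (red : T ⟶ X)

/-- **`ρ̂` of a combination, inside `P₀`** (file C2's `act_combination`): for the linear action `act`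
of `exists_act₀`, `Σ_j a_j • act(g_j) (red ∘ c, red ∘ s) =
(red ∘ (Σ_j a_j • g_j · c), red ∘ (Σ_j a_j • s(g_j⁻¹ ·)))`. [folklore] -/
theorem act_combination₀
    (act : G → (C(U, X) × (G → X)) →ₗ[R] (C(U, X) × (G → X)))
    (hact : ∀ g q, act g q = (𝔠₀⟦g⟧ q.1, fun h => q.2 (g⁻¹ * h)))
    {κ : Type*} (J : Finset κ) (a : κ → R) (gj : κ → G)
    (c : contOneCocycles (subgroupRep T U)) (s : G → T) :
    ∑ j ∈ J, a j • act (gj j) ((𝐫⟦red⟧ c).1, fun h => red.hom (s h)) =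
      ((𝐫⟦red⟧ (∑ j ∈ J, a j • 𝔠⟦T, gj j⟧ c)).1,
        fun h => red.hom ((∑ j ∈ J, a j • fun h' => s ((gj j)⁻¹ * h')) h)) := by
  ext1
  · rw [Prod.fst_sum, red_combination X T U red J a gj c, Submodule.coe_sum]
    refine Finset.sum_congr rfl fun j _ => ?_
    rw [hact, Prod.smul_fst, Submodule.coe_smul, conj0_coe]
  · funext h
    change (∑ j ∈ J, a j • act (gj j) ((𝐫⟦red⟧ c).1, fun h => red.hom (s h))).2 h =
      red.hom ((∑ j ∈ J, a j • fun h' => s ((gj j)⁻¹ * h')) h)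
    rw [Prod.snd_sum, Finset.sum_apply, eta_combination X T red J a gj s h]
    refine Finset.sum_congr rfl fun j _ => ?_
    rw [Prod.smul_snd, hact, Pi.smul_apply]

end Summit.BirchSwinnertonDyer.BirchSwinnertonDyer.Theorems.KimAtThreeD7uRefined

end
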